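import Mathlib
import Literature.Analysis.FluidPDE.SelfSimilarEulerProfile
import Summits.NavierStokesRegularity.NavierStokesRegularity.Theorems.EulerZoomLiouvillePowerGaugeEulerLiouvilleBandClockTools
import HarnessLib

/-!
# «ANY INWARD DRIFT KILLS», tools: the ABSOLUTE band bootstrap and square-root escape along backward arcs
# (crux `EulerZoomLiouville.PowerGaugeEulerLiouville` = stmt-NavierStokesRegularity-19832, THE ONE STATEMENT `stub_selfSimilarC2Needle`; binder `HasFastVorticalChannel` alt 4)

Route `EulerZoomLiouville` (NavierStokesRegularity), crux E, LEAD seat ns-typeII-p2 g13 (own brick, sequel of `…BandClockTools` «only near-circular orbits survive»).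
Class-free ODE tools in the ABSOLUTE radial rate `ℛ(y) = ⟪y, W y⟫` (not the normalised `λ = ℛ/‖y‖²`): along a backward arc `Z′ = −W(Z)` one has EXACTLY
`(ℛ∘Z)′ = −a(Z)` with the forward radial acceleration `a(y) = ‖W y‖² + γ⟪y, W y⟫ + ⟪y, DV(y)(W y)⟫` (`BandClock.hasDerivAt_radialRate_comp`) — no quadratic
correction — so an ABSOLUTE deficit `a ≥ a₀ > 0` on the ABSOLUTE inflow band `−κ ≤ ℛ ≤ 0` pushes `ℛ` below `−κ` in time `κ/a₀` and keeps it there, after which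
`‖Z‖²` grows LINEARLY, `(‖Z‖²)′ = −2ℛ ≥ 2κ`: square-root escape, fast enough for the POWER residence clock `c′R^{2+ρ}` (ρ > 0).

* `DriftClock.abs_band_bootstrap` — along a backward arc on `[t₀, t₁]`, Bernoulli-high and vortical throughout, starting beyond `R₁` with `ℛ(Z t₀) + m₀ ≤ 0`
  (`m₀ ≥ 0`), if `a(y) ≥ a₀` at every vortical point of `{ℋ > h}` with `‖y‖ ≥ R₁` and `−κ ≤ ℛ(y) ≤ 0`, then for every slope `0 ≤ k < a₀` with
  `m₀ + k(t₁ − t₀) ≤ κ`: `‖Z t₀‖ ≤ ‖Z s‖` and `ℛ(Z s) + (m₀ + k(s − t₀)) ≤ 0` on `[t₀, t₁]`.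
* `DriftClock.normSq_ge_of_inflow` — if `ℛ(Z s) ≤ −κ` on `[t₀, t₁]` then `‖Z t₀‖² + 2κ(s − t₀) ≤ ‖Z s‖²`.

WHAT THIS IS NOT: not NS, not E — class-free calculus/ODE lemmas (no budgets, no profile equation), `--supports` stmt-19832; the crux is OPEN; NS regularity
is NOT proved. [folklore; cf. ConstantinIgnatovaVicol2026Putative §3.4 (3.19)–(3.20)]
-/

noncomputable section

-- flat `Theorems/<Route><Decl>…` files of one crux share the namespace of the crux (tree convention: `Summit.<S>.<S>.…`)
set_option linter.dupNamespace false

open Set Filter Topology Metric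
open scoped RealInnerProductSpace

namespace Summit.NavierStokesRegularity.NavierStokesRegularity.Theorems.PowerGaugeEulerLiouville

open Literature.Analysis Literature.Analysis.FluidPDE

namespace DriftClock

variable {γ : ℝ} {V : EuclideanSpace ℝ (Fin 3) → EuclideanSpace ℝ (Fin 3)} {P' : EuclideanSpace ℝ (Fin 3) → ℝ}

/-- **Square-root escape**: along a backward arc with `ℛ(Z s) ≤ −κ` on `[t₀, t₁]`, `‖Z t₀‖² + 2κ(s − t₀) ≤ ‖Z s‖²`. [folklore] -/
theorem normSq_ge_of_inflow {κ t₀ t₁ : ℝ} {Z : ℝ → EuclideanSpace ℝ (Fin 3)}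
    (hZ : ∀ s ∈ Icc t₀ t₁, HasDerivAt Z (-(selfSimilarTransport γ 0 V (Z s))) s)
    (hfast : ∀ s ∈ Icc t₀ t₁, ⟪Z s, selfSimilarTransport γ 0 V (Z s)⟫ ≤ -κ) :
    ∀ s ∈ Icc t₀ t₁, ‖Z t₀‖ ^ 2 + 2 * κ * (s - t₀) ≤ ‖Z s‖ ^ 2 := by
  intro s hs
  set f : ℝ → ℝ := fun s => ‖Z s‖ ^ 2 - 2 * κ * s with hfdef
  have hfd : ∀ s ∈ Icc t₀ t₁, HasDerivAt f (2 * ⟪Z s, -(selfSimilarTransport γ 0 V (Z s))⟫ - 2 * κ) s := by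
    intro s hs
    have h1 := (hZ s hs).norm_sq
    have h2 : HasDerivAt (fun s : ℝ => 2 * κ * s) (2 * κ) s := by
      simpa using (hasDerivAt_id s).const_mul (2 * κ)
    exact h1.sub h2
  have hmono : MonotoneOn f (Icc t₀ t₁) := by
    have hcont : ContinuousOn f (Icc t₀ t₁) := fun s hs => (hfd s hs).continuousAt.continuousWithinAt
    have hdiff : DifferentiableOn ℝ f (interior (Icc t₀ t₁)) := by
      rw [interior_Icc]
      exact fun s hs => (hfd s (Ioo_subset_Icc_self hs)).differentiableAt.differentiableWithinAt
    refine monotoneOn_of_deriv_nonneg (convex_Icc _ _) hcont hdiff fun s hs => ?_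
    rw [interior_Icc] at hs
    rw [(hfd s (Ioo_subset_Icc_self hs)).deriv, inner_neg_right]
    have := hfast s (Ioo_subset_Icc_self hs)
    linarith
  have ht : t₀ ≤ t₁ := le_trans hs.1 hs.2
  have hle : f t₀ ≤ f s := hmono (left_mem_Icc.2 ht) hs hs.1
  simp only [hfdef] at hle
  linarith

/-- **THE ABSOLUTE BAND BOOTSTRAP** (see the module docstring).  `V ∈ C¹`; backward arc `Z′ = −W(Z)` on `[t₀, t₁]`, high and vortical throughout, `‖Z t₀‖ ≥ R₁`,
`ℛ(Z t₀) + m₀ ≤ 0`; absolute inflow band deficit beyond `R₁` (band `−κb ≤ ℛ ≤ 0`, floor `a ≥ a₀`); slope `0 ≤ k < a₀`, `0 ≤ m₀`, `m₀ + k(t₁ − t₀) ≤ κb`.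
Then `‖Z t₀‖ ≤ ‖Z s‖` and `ℛ(Z s) + (m₀ + k(s − t₀)) ≤ 0` on `[t₀, t₁]`. [folklore] -/
theorem abs_band_bootstrap (hV : ContDiff ℝ 1 V) {κb a₀ R₁ h t₀ t₁ m₀ k : ℝ}
    (ht : t₀ ≤ t₁) (hm₀ : 0 ≤ m₀) (hk0 : 0 ≤ k) (hka : k < a₀) (hmc : m₀ + k * (t₁ - t₀) ≤ κb)
    (hdef : ∀ y : EuclideanSpace ℝ (Fin 3), R₁ ≤ ‖y‖ → h < selfSimilarBernoulli γ 0 V P' y → curl V y ≠ 0 →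
      -κb ≤ ⟪y, selfSimilarTransport γ 0 V y⟫ → ⟪y, selfSimilarTransport γ 0 V y⟫ ≤ 0 →
      a₀ ≤ ‖selfSimilarTransport γ 0 V y‖ ^ 2 + γ * ⟪y, selfSimilarTransport γ 0 V y⟫ +
        ⟪y, fderiv ℝ V y (selfSimilarTransport γ 0 V y)⟫)
    {Z : ℝ → EuclideanSpace ℝ (Fin 3)}
    (hZ : ∀ s ∈ Icc t₀ t₁, HasDerivAt Z (-(selfSimilarTransport γ 0 V (Z s))) s)
    (hhigh : ∀ s ∈ Icc t₀ t₁, h < selfSimilarBernoulli γ 0 V P' (Z s))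
    (hvort : ∀ s ∈ Icc t₀ t₁, curl V (Z s) ≠ 0)
    (hZ0 : R₁ ≤ ‖Z t₀‖)
    (hrate0 : ⟪Z t₀, selfSimilarTransport γ 0 V (Z t₀)⟫ + m₀ ≤ 0) :
    ∀ s ∈ Icc t₀ t₁, ‖Z t₀‖ ≤ ‖Z s‖ ∧
      ⟪Z s, selfSimilarTransport γ 0 V (Z s)⟫ + (m₀ + k * (s - t₀)) ≤ 0 := by
  -- notation
  set W := selfSimilarTransport γ 0 V with hWdef
  set ℛ : ℝ → ℝ := fun s => ⟪Z s, W (Z s)⟫ with hℛdef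
  set N : ℝ → ℝ := fun s => ‖Z s‖ ^ 2 with hNdef
  set m : ℝ → ℝ := fun s => m₀ + k * (s - t₀) with hmdef
  set ψ : ℝ → ℝ := fun s => ℛ s + m s with hψdef
  -- derivatives along the arc
  have hℛd : ∀ s ∈ Icc t₀ t₁, HasDerivAt ℛ
      (-(‖W (Z s)‖ ^ 2 + γ * ⟪Z s, W (Z s)⟫ + ⟪Z s, fderiv ℝ V (Z s) (W (Z s))⟫)) s :=
    fun s hs => BandClock.hasDerivAt_radialRate_comp (γ := γ) hV (hZ s hs)
  have hNd : ∀ s ∈ Icc t₀ t₁, HasDerivAt N (2 * ⟪Z s, -(W (Z s))⟫) s := fun s hs => (hZ s hs).norm_sq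
  have hmd : ∀ s, HasDerivAt m k s := by
    intro s
    have := ((hasDerivAt_id s).sub_const t₀).const_mul k |>.const_add m₀
    simpa [hmdef] using this
  have hψd : ∀ s ∈ Icc t₀ t₁, HasDerivAt ψ
      (-(‖W (Z s)‖ ^ 2 + γ * ⟪Z s, W (Z s)⟫ + ⟪Z s, fderiv ℝ V (Z s) (W (Z s))⟫) + k) s :=
    fun s hs => (hℛd s hs).add (hmd s)
  -- continuity on the arc
  have hZc : ContinuousOn Z (Icc t₀ t₁) := fun s hs => (hZ s hs).continuousAt.continuousWithinAt
  have hNc : ContinuousOn N (Icc t₀ t₁) := fun s hs => (hNd s hs).continuousAt.continuousWithinAt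
  have hψc : ContinuousOn ψ (Icc t₀ t₁) := fun s hs => (hψd s hs).continuousAt.continuousWithinAt
  have hnc : ContinuousOn (fun s => ‖Z s‖) (Icc t₀ t₁) := hZc.norm
  -- the good set and its supremum
  set good : ℝ → Prop := fun s => ‖Z t₀‖ ≤ ‖Z s‖ ∧ ψ s ≤ 0 with hgooddef
  have hgood0 : good t₀ := ⟨le_rfl, by simp only [hψdef, hmdef, hℛdef, sub_self, mul_zero, add_zero]; exact hrate0⟩
  set G : Set ℝ := {s | s ∈ Icc t₀ t₁ ∧ ∀ s' ∈ Icc t₀ s, good s'} with hGdef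
  have hG0 : t₀ ∈ G := ⟨left_mem_Icc.2 ht, fun s' hs' => by
    have : s' = t₀ := le_antisymm hs'.2 hs'.1
    rw [this]; exact hgood0⟩
  have hGne : G.Nonempty := ⟨t₀, hG0⟩
  have hGbdd : BddAbove G := ⟨t₁, fun s hs => hs.1.2⟩
  set sstar := sSup G with hsdef
  have hs0 : t₀ ≤ sstar := le_csSup hGbdd hG0
  have hs1 : sstar ≤ t₁ := csSup_le hGne fun s hs => hs.1.2
  -- good below the supremum
  have hgood_lt : ∀ s, t₀ ≤ s → s < sstar → good s := by
    intro s hs0' hs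
    obtain ⟨σ, hσG, hsσ⟩ := exists_lt_of_lt_csSup hGne hs
    exact hσG.2 s ⟨hs0', hsσ.le⟩
  -- the good conditions are closed on `[t₀, t₁]`
  have hclosed : IsClosed {s | s ∈ Icc t₀ t₁ ∧ good s} := by
    have h1 : IsClosed {s | s ∈ Icc t₀ t₁ ∧ ‖Z t₀‖ ≤ ‖Z s‖} := by
      have := hnc.preimage_isClosed_of_isClosed isClosed_Icc (isClosed_Ici (a := ‖Z t₀‖))
      convert this using 1
      ext s; simp [Set.mem_preimage]
    have h2 : IsClosed {s | s ∈ Icc t₀ t₁ ∧ ψ s ≤ 0} := by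
      have := hψc.preimage_isClosed_of_isClosed isClosed_Icc (isClosed_Iic (a := (0 : ℝ)))
      convert this using 1
      ext s; simp [Set.mem_preimage]
    have e : {s | s ∈ Icc t₀ t₁ ∧ good s} = {s | s ∈ Icc t₀ t₁ ∧ ‖Z t₀‖ ≤ ‖Z s‖} ∩ {s | s ∈ Icc t₀ t₁ ∧ ψ s ≤ 0} := by
      ext s; simp only [hgooddef, mem_setOf_eq, mem_inter_iff]; tauto
    rw [e]; exact h1.inter h2
  have hgood_star : good sstar := by
    rcases hs0.lt_or_eq with hpos | hzero
    · have hsub : Ico t₀ sstar ⊆ {s | s ∈ Icc t₀ t₁ ∧ good s} := fun s hs =>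
        ⟨⟨hs.1, le_trans hs.2.le hs1⟩, hgood_lt s hs.1 hs.2⟩
      have hcl := hclosed.closure_subset_iff.2 hsub
      have hmem : sstar ∈ closure (Ico t₀ sstar) := by
        rw [closure_Ico hpos.ne]; exact right_mem_Icc.2 hs0
      exact (hcl hmem).2
    · rw [← hzero]; exact hgood0
  have hgood_le : ∀ s ∈ Icc t₀ sstar, good s := by
    intro s hs
    rcases hs.2.lt_or_eq with hl | he
    · exact hgood_lt s hs.1 hl
    · rw [he]; exact hgood_star
  -- ### the supremum is `t₁`
  have hstar : sstar = t₁ := by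
    by_contra hne
    have hlt : sstar < t₁ := lt_of_le_of_ne hs1 hne
    have hmem : sstar ∈ Icc t₀ t₁ := ⟨hs0, hs1⟩
    -- facts at `sstar`
    have hfar : R₁ ≤ ‖Z sstar‖ := le_trans hZ0 hgood_star.1
    have hm_le : m sstar ≤ κb := by
      have : k * (sstar - t₀) ≤ k * (t₁ - t₀) := mul_le_mul_of_nonneg_left (by linarith) hk0
      simp only [hmdef]; linarith
    have hm_ge : 0 ≤ m sstar := by
      simp only [hmdef]; nlinarith
    -- (1) `ψ < 0` just to the right of `sstar`
    have hψneg : ∀ᶠ s in 𝓝[>] sstar, ψ s < 0 := by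
      rcases (hgood_star.2).lt_or_eq with hlt0 | heq0
      · -- by continuity
        have hc : ContinuousWithinAt ψ (Icc t₀ t₁) sstar := hψc sstar hmem
        have h1 : ∀ᶠ s in 𝓝[Icc t₀ t₁] sstar, ψ s < 0 := hc.eventually (gt_mem_nhds hlt0)
        have h2 : 𝓝[>] sstar ≤ 𝓝[Icc t₀ t₁] sstar ⊔ 𝓝[(Icc t₀ t₁)ᶜ] sstar := by
          rw [← nhdsWithin_union, union_compl_self, nhdsWithin_univ]; exact nhdsWithin_le_nhds
        -- points just right of `sstar` and `< t₁` lie in `Icc t₀ t₁`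
        have h3 : ∀ᶠ s in 𝓝[>] sstar, s ∈ Icc t₀ t₁ := by
          filter_upwards [Ioo_mem_nhdsGT hlt] with s hs
          exact ⟨le_trans hs0 hs.1.le, hs.2.le⟩
        have h4 : ∀ᶠ s in 𝓝 sstar, s ∈ Icc t₀ t₁ → ψ s < 0 := eventually_nhdsWithin_iff.1 h1
        filter_upwards [h3, nhdsWithin_le_nhds h4] with s hs hs'
        exact hs' hs
      · -- tight: the point is in the inflow half-band, the deficit makes `ψ′ < 0`
        have hℛeq : ℛ sstar = -(m sstar) := by
          have : ψ sstar = ℛ sstar + m sstar := rfl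
          linarith
        have hR₁le : R₁ ≤ ‖Z sstar‖ := hfar
        have hband_lo : -κb ≤ ⟪Z sstar, W (Z sstar)⟫ := by
          show -κb ≤ ℛ sstar
          rw [hℛeq]; linarith
        have hband_hi : ⟪Z sstar, W (Z sstar)⟫ ≤ 0 := by
          show ℛ sstar ≤ 0
          rw [hℛeq]; linarith
        have hdef' := hdef (Z sstar) hR₁le (hhigh sstar hmem) (hvort sstar hmem) hband_lo hband_hi
        -- the derivative of `ψ` at `sstar` is `≤ k − a₀ < 0`
        have hψ' := hψd sstar hmem
        have hderiv_neg : -(‖W (Z sstar)‖ ^ 2 + γ * ⟪Z sstar, W (Z sstar)⟫ + ⟪Z sstar, fderiv ℝ V (Z sstar) (W (Z sstar))⟫) + k < 0 := by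
          linarith
        have hev := BandClock.eventually_lt_right_of_hasDerivAt_neg hψ' hderiv_neg
        rw [heq0] at hev
        exact hev
    -- (2) choose `ε > 0` with `(sstar, sstar + ε) ⊆ {ψ < 0} ∩ (sstar, t₁)`
    have hev2 : ∀ᶠ s in 𝓝[>] sstar, ψ s < 0 ∧ s < t₁ :=
      hψneg.and (Filter.eventually_of_mem (Ioo_mem_nhdsGT hlt) fun s hs => hs.2)
    obtain ⟨b, hb, hbsub⟩ := (mem_nhdsGT_iff_exists_Ioo_subset).1 hev2
    set ε : ℝ := (min b t₁ - sstar) / 2 with hεdef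
    have hεpos : 0 < ε := by
      have : sstar < min b t₁ := lt_min hb hlt
      rw [hεdef]; linarith
    have hεb : sstar + ε < b := by
      have : min b t₁ ≤ b := min_le_left _ _
      rw [hεdef]; linarith
    have hεt : sstar + ε < t₁ := by
      have : min b t₁ ≤ t₁ := min_le_right _ _
      rw [hεdef]; linarith
    have hψle : ∀ s ∈ Icc sstar (sstar + ε), ψ s ≤ 0 := by
      intro s hs
      rcases hs.1.lt_or_eq with hl | he
      · exact (hbsub ⟨hl, lt_of_le_of_lt hs.2 hεb⟩).1.le
      · rw [← he]; exact hgood_star.2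
    -- (3) on `[sstar, sstar + ε]` the radius is non-decreasing (`N′ = −2ℛ ≥ 2mN ≥ 0`)
    have hsubI : Icc sstar (sstar + ε) ⊆ Icc t₀ t₁ := fun s hs => ⟨le_trans hs0 hs.1, le_trans hs.2 hεt.le⟩
    have hNmono : MonotoneOn N (Icc sstar (sstar + ε)) := by
      have hcont : ContinuousOn N (Icc sstar (sstar + ε)) := hNc.mono hsubI
      have hdiff : DifferentiableOn ℝ N (interior (Icc sstar (sstar + ε))) := by
        rw [interior_Icc]
        exact fun s hs => (hNd s (hsubI (Ioo_subset_Icc_self hs))).differentiableAt.differentiableWithinAt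
      refine monotoneOn_of_deriv_nonneg (convex_Icc _ _) hcont hdiff fun s hs => ?_
      rw [interior_Icc] at hs
      have hsI : s ∈ Icc sstar (sstar + ε) := Ioo_subset_Icc_self hs
      rw [(hNd s (hsubI hsI)).deriv, inner_neg_right]
      have hψs : ψ s ≤ 0 := hψle s hsI
      have hms : 0 ≤ m s := by simp only [hmdef]; nlinarith [hs.1, hs0]
      have : ℛ s ≤ -(m s) := by
        have : ψ s = ℛ s + m s := rfl
        linarith
      show 0 ≤ 2 * -⟪Z s, W (Z s)⟫
      have : ⟪Z s, W (Z s)⟫ = ℛ s := rfl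
      linarith
    have hrad : ∀ s ∈ Icc sstar (sstar + ε), ‖Z t₀‖ ≤ ‖Z s‖ := by
      intro s hs
      have hNle : N sstar ≤ N s := hNmono (left_mem_Icc.2 (by linarith)) hs hs.1
      have h1 : ‖Z sstar‖ ^ 2 ≤ ‖Z s‖ ^ 2 := hNle
      have h2 : ‖Z sstar‖ ≤ ‖Z s‖ := (pow_le_pow_iff_left₀ (norm_nonneg _) (norm_nonneg _) two_ne_zero).1 h1
      exact le_trans hgood_star.1 h2
    -- (4) so `sstar + ε ∈ G`: contradiction
    have hmemG : sstar + ε ∈ G := by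
      refine ⟨⟨by linarith, hεt.le⟩, fun s' hs' => ?_⟩
      rcases le_or_gt s' sstar with hle | hgt
      · exact hgood_le s' ⟨hs'.1, hle⟩
      · exact ⟨hrad s' ⟨hgt.le, hs'.2⟩, hψle s' ⟨hgt.le, hs'.2⟩⟩
    have := le_csSup hGbdd hmemG
    linarith
  -- ### conclusion
  intro s hs
  have hsg : good s := hgood_le s ⟨hs.1, by rw [hstar]; exact hs.2⟩
  exact ⟨hsg.1, hsg.2⟩

end DriftClock

end Summit.NavierStokesRegularity.NavierStokesRegularity.Theorems.PowerGaugeEulerLiouville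

end
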